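import Summits.CriticalPhenomena.CardyFormulaZ2.Theses.CardyAnchoredRigidity
import Summits.CriticalPhenomena.CardyFormulaZ2.Theses.CardyLocalRigidity
import Summits.CriticalPhenomena.CardyFormulaZ2.Theses.CardyMirrorMonotone
import Summits.CriticalPhenomena.CardyFormulaZ2.Theorems.CardyAnchoredRigiditySubseqCardyStubDiagonalCauchy
import Summits.CriticalPhenomena.CardyFormulaZ2.Theorems.CardyAnchoredRigiditySubseqCardyStubCountableApprox
import Summits.CriticalPhenomena.CardyFormulaZ2.Theorems.CardyAnchoredRigiditySubseqCardyReduction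
import Summits.CriticalPhenomena.CardyFormulaZ2.Theorems.CardyAnchoredRigiditySubseqCardyJointLimitCluster
import Summits.CriticalPhenomena.CardyFormulaZ2.Theorems.CardyAnchoredRigiditySubseqCardyRectDuality
import Summits.CriticalPhenomena.CardyFormulaZ2.Theorems.CardyAnchoredRigiditySubseqCardyFrameEquivalence
import Summits.CriticalPhenomena.CardyFormulaZ2.Theorems.CardyAnchoredRigiditySubseqCardyDilationRigidity
import Summits.CriticalPhenomena.CardyFormulaZ2.Theorems.CardyAnchoredRigiditySubseqCardySelfDual
import Summits.CriticalPhenomena.CardyFormulaZ2.Theorems.CardyAnchoredRigiditySubseqCardyKernelFacts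
import Summits.CriticalPhenomena.CardyFormulaZ2.Theorems.CardyAnchoredRigiditySubseqCardySeqMartingaleRigidity

/-!
# Skeleton for crux `SubseqCardy` (stmt-CriticalPhenomena-5768), line `registered` (birth), rev c5

Route `CardyAnchoredRigidity` (decl shared verbatim with route `CardyLocalRigidity`), sub-problem
`CardyFormulaZ2`, summit `CriticalPhenomena`. Lead: prover `line-stmt-CriticalPhenomena-5768-c5`
(2026-08-17), continuing rev c4 (`Cruxes/SubseqCardy/Lines/birth.lean`; birth sha 7da98783…, rev c1
skeleton sha 8b8088de…, rev c2 sha 2c1253d1…, rev c3 sha 719a53a8…, rev c4 sha 71d8c92f…). Stubs S2,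
S3 UNCHANGED in rev c5 (they ARE the open items 8266 / 8271); what c5 adds (section "Cycle c5"
below): the KERNEL FACTS for SEQUENTIAL crossing kernels (the hypothesis of S3 / 8271 / 4680 / 8850)
— Cardy's functional equation, strict monotonicity, continuity, boundary values — and the reduction
of S3 / 8271 to the sequential crossing-martingale input (all analysis of the martingale route done);
c4 added the frame equivalence, dilation rigidity of unique limits, and GENERAL SELF-DUALITY of every
joint sequential limit on every conformal rectangle.

The crux (route decl, FIXED):

  `SubseqCardy : ∃ u : ℕ → ℝ, u → 0⁺ ∧ ∀ R φ x, R.IsUniformizing φ x →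
      bondDomainCrossingProb R (u n) → cardyFunction (crossRatio x)`.

## State after cycle c2 (same composition idea: tightness → conformal invariance → identification)

* S1a `stub_diagonalCauchy` — LANDED (p145264, `Theorems/CardyAnchoredRigiditySubseqCardyStubDiagonalCauchy.lean`).
* S1b `stub_countableApprox` — LANDED (part 1 `stub_bondNearCrude` p147329,
  `…StubCountableApproxBondNearCrude.lean`; part 2 `…StubCountableApprox.lean`): separability of the
  plane homeomorphisms for compact convergence + Schramm–Smirnov Lemma 5.1 domain perturbation for
  crude crossings (`stub_DomainPerturbation`) + the bond ≈ crude sandwich.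
  Hence S1 — ONE mesh sequence with a JOINT limit of the crossing probabilities of EVERY conformal
  rectangle — is a theorem (`stub_diagonalCauchy stub_countableApprox`; named `jointSubseqLimit` in
  `Theorems/CardyAnchoredRigiditySubseqCardyJointLimit.lean`), and so is precompactness along every
  mesh sequence (`exists_strictMono_jointLimit`, same file).
* S2 `stub_limitConformal` (registered signature kept verbatim, still `sorry`) is, given S1b,
  EQUIVALENT to the existing open target `CardyMirrorMonotone.SubseqConformalInvariance`
  (stmt-CriticalPhenomena-8266, "X_M" — conformal invariance of bond-ℤ² crossing sublimits, Schramm's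
  Problem 2.11 grade; verbatim twins stmt-4678, `CardyBlackNoise.SubseqConformalInvariance`):
  `stub_limitConformal_iff_subseqConformalInvariance` below (both directions landed in
  `Theorems/CardyAnchoredRigiditySubseqCardyReduction.lean`).
* S3 `stub_conformalLimitIsCardy` (registered signature kept verbatim, still `sorry`) is EQUIVALENT
  to the existing open crux `CardyMirrorMonotone.SubseqRigidity` (stmt-CriticalPhenomena-8271;
  verbatim twins stmt-4680 `CardyExpCovariance.CardyRigiditySeq`, stmt-8850
  `CardyBlackNoise.SubseqCardyRigidity`): `stub_conformalLimitIsCardy_iff_subseqRigidity` below.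
* Compositions (sorry-free): `SubseqCardy_of (h₂ : S2) (h₃ : S3)` (S1 discharged), and BY NAME over
  the two existing items, `SubseqCardy_of_items : SubseqConformalInvariance → SubseqRigidity → SubseqCardy`
  (landed as the registered sub-goal `subseqCardy_of_items`).

So the line is complete modulo two EXISTING items of sibling routes: the crux is `8266 ∧ 8271`-hard
and nothing else in it can move here (lead outcome `blocked-on: stmt-CriticalPhenomena-8266`, 8271 named).

## Cycle c3: structure of joint sequential limits (all LANDED, `--supports` this crux)

A JOINT SEQUENTIAL LIMIT is a pair (`u → 0⁺`, `g`) with `bondDomainCrossingProb R (u n) → g R` for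
every conformal rectangle `R` — the hypothesis of S2 and S3. Unconditionally (namespace
`…SubseqCardy.Birth.JointLimit`):

* translation invariance `g (e + R) = g R` for ALL `e ∈ ℂ` (`JointLimit.map_addLeft`, registered
  sub-goal `jointLimit_translationInvariant`, file `Theorems/…SubseqCardyJointLimitSymmetry.lean`,
  p154563), resting on the translation-UNIFORM Schramm–Smirnov perturbation bound for crude crossings
  (`JointLimit.crude_translate_perturb`, sub-goal `stub_crudeTranslatePerturb`,
  `Theorems/…SubseqCardyTranslationPerturbation.lean`, p154269) and exact crude-lattice invariance;
* `D₄` invariance (quarter turn `JointLimit.map_mul_I`, conjugation `JointLimit.map_conj`);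
* dilation INTERTWINING: `R ↦ g (c·R)` is the joint limit along `u n / c` (`JointLimit.tendsto_dilate`)
  — the family of joint limits is dilation invariant; covariance of ONE `g` is the open part;
* continuity in the Schramm–Smirnov topology (`JointLimit.abs_sub_map_le`);
* the dictionary `|bondDomainCrossingProb R δ - quadCrossingProb δ R| → 0` per rectangle
  (`JointLimit.eventually_abs_bond_sub_quadCrossingProb_le`), whence, CONDITIONAL on the named fact
  `dkkmo_crossing_rotation_invariance` (DKKMO Cor. 1.3, q = 1), rotation invariance by every angle
  (`JointLimit.map_rotateQuad`, sub-goal `jointLimit_rotationInvariant_of_dkkmo`,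
  `Theorems/…SubseqCardyJointLimitRotation.lean`, p154777).

* cluster points = joint sequential limits (`JointLimit.exists_tendsto_of_mapClusterPt`,
  sub-goal `clusterPt_iff_jointLimit`, `Theorems/…SubseqCardyJointLimitCluster.lean`, p155559): the
  frame's cluster set `Λ'` (items 5767/5769) is exactly the set of objects S2/S3 quantify over, so
  all of the above holds for every `g ∈ Λ'` (`ClusterPt.map_addLeft`, `…map_rotateQuad`, …);
* the first VALUE: every joint limit gives the unit box `(0,1)²`, crossed bottom-to-top, the value
  `1/2` (`JointLimit.btUnitBox_eq_half`, sub-goal `jointLimit_btUnitBox_eq_half`,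
  `Theorems/…SubseqCardySquareHalf.lean`, p156399: fitted meshes via the tree's `scaleContinuity`,
  `h(n+1,n) = 1/2`, width monotonicity, SS-continuity under stretches); part 6 (sub-goal
  `cardy_unitSquareQuad`, `Theorems/…SubseqCardySquareCardy.lean`): every square, any size /
  position / opposite-side marking, gets `1/2` from every joint limit, the full limit is `1/2`, and
  CARDY'S FORMULA HOLDS FOR THE SQUARE `unitSquareQuad` — the `η = 1/2` instance of the conjunct
  `CardyFormulaZ2`, unconditional (p157536);
* SELF-DUALITY on rectangles: `g (LR box (0,w)×(0,1)) + g (BT box) = 1` for every joint limit and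
  every `w > 0` (`JointLimit.lr_add_bt_eq_one`, sub-goal `jointLimit_rectSelfDual`,
  `Theorems/…SubseqCardyRectDuality.lean`, p158108: planar duality at the fitted meshes `1/m`,
  `1/(m-1)` + width monotonicity + scale continuity + SS-continuity under stretches).

So, given DKKMO, every joint limit is invariant under the full isometry group of the plane, and what
remains of S2 is EXACTLY dilation + inversion (Möbius) covariance of one joint limit — the recorded
open heart, now isolated in the tree's own vocabulary. Also landed in c3: the registered stub
`stub_jointPrecompactness` of item 8266's skeleton (= `exists_strictMono_jointLimit`, p153265).

## Cycle c4 (all LANDED, `--supports` this crux)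

* FRAME EQUIVALENCE (registered sub-goal `subseqCardy_iff_cardyShadow_clusterPt`,
  `Theorems/…SubseqCardyFrameEquivalence.lean`, p160522): `SubseqCardy ↔ ∃ g, (g is a Cardy shadow:
  g R = F(crossRatio x) at every uniformizing datum) ∧ MapClusterPt g (𝓝[>] 0) (crossing-function path)`
  — the crux is EQUIVALENT to what the Assembly / `CardyShadowIsolated` consume (the refuters'
  standing "over-strong" objection is void: the extra strength is only apparent).
* DILATION RIGIDITY (sub-goals `limit_dilationInvariant_of_tendsto`,
  `clusterPt_dilationInvariant_of_subsingleton`, `Theorems/…SubseqCardyDilationRigidity.lean`, p160527):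
  if the FULL limit exists for every conformal rectangle (resp. the cluster set has at most one
  point) then it is dilation invariant — existence alone gives scale invariance (dilation
  intertwining of part 2 + uniqueness of limits); what stays open in S2 is the Möbius step
  (barrier `ScaleCovarianceNotMoebius`).
* GENERAL SELF-DUALITY (sub-goal `jointLimit_selfDual`, `Theorems/…SubseqCardySelfDual.lean`, p162053;
  parts `…SelfDualNotBoth` p161147, `…SelfDualDualChain` p161227, `…SelfDualChartBridge` p161242,
  `…SelfDualNearCharts` p161246, `…SelfDualMesh` p161787): **for every joint sequential limit `g`,
  every conformal rectangle `R` and its cyclic re-marking `R⁺` (same carrier, arcs shifted by one),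
  `g R + g R⁺ = 1`** — an elementary proof through Schramm–Smirnov's quad-crossing events: at mesh
  `δ`, "not both" (an open crossing of the square model and a dual-open crossing of a slightly
  harder transversal rectangle on `δℤ² + δ(½,½)` are in plus position) and "at least one" (no open
  crossing ⇒ dual path ⇒ dual face chain ⇒ a dual crossing of a slightly easier transversal
  rectangle), the half-mesh shift of the dual lattice being absorbed by a two-chart monotonicity
  lemma and the margins by Schramm–Smirnov continuity of `g` (part 2). (The limit statement also
  follows from `CardyOrderDuality.DualSum`, closed the same day by the `SimilarityUpgrade` lead via
  the Schramm–Smirnov space; the two proofs are independent.) For a conformally invariant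
  `g = G ∘ crossRatio` (S2) this is Cardy's functional equation `G η + G (1-η) = 1`.

## Cycle c5 (all LANDED, `--supports` this crux): kernel facts for SEQUENTIAL crossing kernels

A SEQUENTIAL CROSSING KERNEL is a pair (`u → 0⁺`, `f : ℝ → ℝ`) with `bondDomainCrossingProb R (u n)
→ f (crossRatio x)` for every conformal rectangle and every uniformizing datum (HYPSEQ) — exactly the
hypothesis of S3 ⟺ stmt-8271 (`SubseqRigidity`) and of its twins stmt-4680 / stmt-8850; given S2,
`(u, G)` is one. Unconditionally (namespaces `…Birth.Kernel`, `…Birth.Lattice`, `…Birth.JointLimit`):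

* part 1 (sub-goal `seqKernel_selfDual`, `Theorems/…SubseqCardyKernelDuality.lean`, p165210): a
  sequential kernel defines a joint limit (`Kernel.exists_jointLimit`); **`f η + f (1-η) = 1` on
  `(0,1)`** (general self-duality of c4 + cyclic re-marking `Kernel.exists_shift_datum`),
  `f (1/2) = 1/2`, `0 < f < 1`;
* lattice input (sub-goal `crossingProb_submultiplicative`, `Theorems/…SubseqCardyLatticeSubmult.lean`,
  p165330): **`h(a₁ + a₂ + 1, b) ≤ h(a₁, b) · h(a₂, b)`** for the bond-`ℤ²` rectangle crossing
  probabilities (last-visit column cut + independence of disjoint edge sets + translation invariance);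
* part 2 (sub-goal `jointLimit_lrBox_laws`, `Theorems/…SubseqCardyBoxLimits.lean`, p165758): for EVERY
  joint sequential limit `g`, the left-to-right values `g (L_w)` of the boxes `(0,w) × (0,1)` are
  antitone, SUB-MULTIPLICATIVE, STRICTLY decreasing, `≤ 2^{-(k+1)}` at width `k + 1`, uniformly small
  for long boxes, and continuous in `w` (fitted meshes + `bond_lr_eq` + SS-continuity);
* part 3 (sub-goals `seqKernelFacts`, `seqKernel_strictMonoOn`, `Theorems/…SubseqCardyKernelFacts.lean`,
  p166126): **`f` is STRICTLY increasing and CONTINUOUS on `(0,1)` with `f(0⁺) = 0`, `f(1⁻) = 1`**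
  (`g (L_w) = f (η w)`, `η` the Bollobás–Riordan modulus `rectangle_crossRatio_eq_of_aspectRatio_holds`,
  via `stub_boxCrossRatio` + box duality) — the exact sequential twin of the landed full-filter
  `stub_kernelFacts` of crux `CardyRigidity` (stmt-0746);
* part 4 (sub-goal `subseqRigidity_of_seqCrossingMartingale`,
  `Theorems/…SubseqCardySeqMartingaleRigidity.lean`): with the landed `stub_kernelAffineCardy`
  (p152942, line `crossing_martingale` of stmt-0746), **a sequential crossing kernel admitting a regular
  driving process with the `f`-crossing-martingale property IS Cardy's `F`**
  (`Kernel.eqOn_cardyFunction_of_crossingMartingale`); hence S3 / stmt-8271 follow from the SEQUENTIAL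
  twin of STUB A of that line (tightness + Kemppainen–Smirnov regularity + passage of the discrete
  crossing martingale to the limit along `u`), and the crux follows from X_M (8266) plus that input
  (`subseqCardy_of_subseqConformalInvariance_of_seqCrossingMartingale`, also `SubseqCardy_of_XM_of_seqCM`
  below). The crux remains `8266 ∧ 8271`; 8271 now has TWO sufficient percolation-side inputs
  (Camia–Newman along `u`; crossing martingale along `u`) whose analytic halves are theorems.

Disproof used: none on file (`ledger crux ls stmt-CriticalPhenomena-5768`, 2026-08-17, re-read by c5 13:46Z: no
`Disproof.lean`; no `stub-false` / `stub-misstated` evidence notes on the item). Non-vacuity: every joint sequential limit is `(0,1)`-valued on every rectangle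
(`jointLimit_mem_Ioo`, Reduction file, from RSW `discreteCrossingProb_clusterPt_mem_Ioo_holds`).
-/

namespace Summit.CriticalPhenomena.CardyFormulaZ2.Cruxes.SubseqCardy.Birth

open Filter Topology
open Summit.CriticalPhenomena.CardyFormulaZ2.Theses

/-! ### S1 discharged (S1a + S1b, landed)

`stub_diagonalCauchy stub_countableApprox : ∃ u → 0⁺, ∃ g, ∀ R, bondDomainCrossingProb R (u n) → g R`
is now a closed term (both stubs landed; the named corollaries `jointSubseqLimit`,
`exists_strictMono_jointLimit` live in `Theorems/CardyAnchoredRigiditySubseqCardyJointLimit.lean`). -/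

/-! ### Registered stubs still open (signatures self-contained over Literature declarations) -/

/-- **S2 `stub_limitConformal` — every joint sequential limit is conformally invariant** (the
open heart of the crux; given S1b it is EQUIVALENT to the open target stmt-CriticalPhenomena-8266
`CardyMirrorMonotone.SubseqConformalInvariance`, see `stub_limitConformal_iff_subseqConformalInvariance`;
DKKMO 2020 Thm 1.2/1.4 gives rotations only; dilations / Möbius open; Smirnov 2001 is 𝕋-only). If
along `u n → 0⁺` the crossing probabilities of every conformal rectangle converge to `g`, then `g`
factors through the conformal modulus: `g R = G (crossRatio x)` for every uniformizing datum
`(φ, x)` of `R`. Size XL (open problem). Why it might fail: a ℤ² subsequential limit could be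
rotation- but not dilation-covariant (log-periodic impostor), or Möbius covariance could fail while
similarity covariance holds. -/
theorem stub_limitConformal :
    ∀ u : ℕ → ℝ, Filter.Tendsto u Filter.atTop (nhdsWithin (0 : ℝ) (Set.Ioi 0)) →
      ∀ g : Literature.Probability.RandomPlanarGeometry.ConformalRectangle → ℝ,
        (∀ R : Literature.Probability.RandomPlanarGeometry.ConformalRectangle,
          Filter.Tendsto (fun n => Literature.Probability.Percolation.bondDomainCrossingProb R (u n))
            Filter.atTop (nhds (g R))) →
        ∃ G : ℝ → ℝ,
          ∀ (R : Literature.Probability.RandomPlanarGeometry.ConformalRectangle)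
            (φ : Literature.Probability.RandomPlanarGeometry.ConformalEquiv
              UpperHalfPlane.upperHalfPlaneSet R.carrier)
            (x : Fin 4 → ℝ), R.IsUniformizing φ x →
            g R = G (Literature.Probability.RandomPlanarGeometry.crossRatio x) := by
  sorry

/-- **S3 `stub_conformalLimitIsCardy` — a conformally invariant joint sequential limit of bond-ℤ²
crossing probabilities takes Cardy's value** (identification; EQUIVALENT to the open crux
stmt-CriticalPhenomena-8271 `CardyMirrorMonotone.SubseqRigidity`, see
`stub_conformalLimitIsCardy_iff_subseqRigidity`; Schramm's principle + LSW locality ⇒ κ = 6 + SLE₆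
hitting law = Cardy; Lawler–Schramm–Werner 2001, Smirnov 2001, Camia–Newman 2007 §5–7; in tree the
SLE₆ side `sle_six_measureReal_hitsBefore_holds`, `eq_six_of_isSLELaw_of_isTargetIndependent_of_four_lt`).
Size L/XL. Why it might fail: the transfer from Jordan-rectangle crossing limits to the exploration
path's law needs crossing control in rough random-slit domains. -/
theorem stub_conformalLimitIsCardy :
    ∀ u : ℕ → ℝ, Filter.Tendsto u Filter.atTop (nhdsWithin (0 : ℝ) (Set.Ioi 0)) →
      ∀ g : Literature.Probability.RandomPlanarGeometry.ConformalRectangle → ℝ,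
        (∀ R : Literature.Probability.RandomPlanarGeometry.ConformalRectangle,
          Filter.Tendsto (fun n => Literature.Probability.Percolation.bondDomainCrossingProb R (u n))
            Filter.atTop (nhds (g R))) →
        ∀ G : ℝ → ℝ,
          (∀ (R : Literature.Probability.RandomPlanarGeometry.ConformalRectangle)
            (φ : Literature.Probability.RandomPlanarGeometry.ConformalEquiv
              UpperHalfPlane.upperHalfPlaneSet R.carrier)
            (x : Fin 4 → ℝ), R.IsUniformizing φ x →
            g R = G (Literature.Probability.RandomPlanarGeometry.crossRatio x)) →
          ∀ (R : Literature.Probability.RandomPlanarGeometry.ConformalRectangle)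
            (φ : Literature.Probability.RandomPlanarGeometry.ConformalEquiv
              UpperHalfPlane.upperHalfPlaneSet R.carrier)
            (x : Fin 4 → ℝ), R.IsUniformizing φ x →
            g R = Literature.Probability.RandomPlanarGeometry.cardyFunction
              (Literature.Probability.RandomPlanarGeometry.crossRatio x) := by
  sorry

/-! ### Name-keyed aliases of the two open statements -/
namespace Registered

/-- Statement of `stub_limitConformal` (S2), keyed by the registered stub name. -/
abbrev stub_limitConformal : Prop :=
  ∀ u : ℕ → ℝ, Filter.Tendsto u Filter.atTop (nhdsWithin (0 : ℝ) (Set.Ioi 0)) →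
    ∀ g : Literature.Probability.RandomPlanarGeometry.ConformalRectangle → ℝ,
      (∀ R : Literature.Probability.RandomPlanarGeometry.ConformalRectangle,
        Filter.Tendsto (fun n => Literature.Probability.Percolation.bondDomainCrossingProb R (u n))
          Filter.atTop (nhds (g R))) →
      ∃ G : ℝ → ℝ,
        ∀ (R : Literature.Probability.RandomPlanarGeometry.ConformalRectangle)
          (φ : Literature.Probability.RandomPlanarGeometry.ConformalEquiv
            UpperHalfPlane.upperHalfPlaneSet R.carrier)
          (x : Fin 4 → ℝ), R.IsUniformizing φ x →
          g R = G (Literature.Probability.RandomPlanarGeometry.crossRatio x)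

/-- Statement of `stub_conformalLimitIsCardy` (S3), keyed by the registered stub name. -/
abbrev stub_conformalLimitIsCardy : Prop :=
  ∀ u : ℕ → ℝ, Filter.Tendsto u Filter.atTop (nhdsWithin (0 : ℝ) (Set.Ioi 0)) →
    ∀ g : Literature.Probability.RandomPlanarGeometry.ConformalRectangle → ℝ,
      (∀ R : Literature.Probability.RandomPlanarGeometry.ConformalRectangle,
        Filter.Tendsto (fun n => Literature.Probability.Percolation.bondDomainCrossingProb R (u n))
          Filter.atTop (nhds (g R))) →
      ∀ G : ℝ → ℝ,
        (∀ (R : Literature.Probability.RandomPlanarGeometry.ConformalRectangle)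
          (φ : Literature.Probability.RandomPlanarGeometry.ConformalEquiv
            UpperHalfPlane.upperHalfPlaneSet R.carrier)
          (x : Fin 4 → ℝ), R.IsUniformizing φ x →
          g R = G (Literature.Probability.RandomPlanarGeometry.crossRatio x)) →
        ∀ (R : Literature.Probability.RandomPlanarGeometry.ConformalRectangle)
          (φ : Literature.Probability.RandomPlanarGeometry.ConformalEquiv
            UpperHalfPlane.upperHalfPlaneSet R.carrier)
          (x : Fin 4 → ℝ), R.IsUniformizing φ x →
          g R = Literature.Probability.RandomPlanarGeometry.cardyFunction
            (Literature.Probability.RandomPlanarGeometry.crossRatio x)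

end Registered

/-! ### The two open stubs are existing items (both directions landed in the Reduction file) -/

/-- **S2 ⟺ X_M**: the registered stub `stub_limitConformal` is equivalent to the open target
`CardyMirrorMonotone.SubseqConformalInvariance` (stmt-CriticalPhenomena-8266), S1b being a theorem. -/
theorem stub_limitConformal_iff_subseqConformalInvariance :
    Registered.stub_limitConformal ↔ CardyMirrorMonotone.SubseqConformalInvariance :=
  ⟨subseqConformalInvariance_of_stub_limitConformal stub_countableApprox,
    stub_limitConformal_of_subseqConformalInvariance⟩

/-- **S3 ⟺ sequential rigidity**: the registered stub `stub_conformalLimitIsCardy` is equivalent to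
the open crux `CardyMirrorMonotone.SubseqRigidity` (stmt-CriticalPhenomena-8271). -/
theorem stub_conformalLimitIsCardy_iff_subseqRigidity :
    Registered.stub_conformalLimitIsCardy ↔ CardyMirrorMonotone.SubseqRigidity :=
  ⟨subseqRigidity_of_stub_conformalLimitIsCardy, stub_conformalLimitIsCardy_of_subseqRigidity⟩

/-! ### The composition: the two open stubs imply the crux, by name (S1 discharged) -/

/-- **`SubseqCardy` from S2 + S3** (pure logic, no `sorry`; S1 is the closed term
`stub_diagonalCauchy stub_countableApprox`):
take the mesh sequence `u → 0⁺` and the joint limit `g` of S1; S2 factors `g` through the conformal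
modulus; S3 identifies the factor with Cardy's function at every uniformizing datum, so the limit
`g R` IS `cardyFunction (crossRatio x)`. -/
theorem SubseqCardy_of (h₂ : Registered.stub_limitConformal) (h₃ : Registered.stub_conformalLimitIsCardy) :
    Summit.CriticalPhenomena.CardyFormulaZ2.Theses.CardyAnchoredRigidity.SubseqCardy := by
  -- S1 (proved): one sequence of meshes with a JOINT limit over all conformal rectangles
  obtain ⟨u, hu, g, hg⟩ := stub_diagonalCauchy stub_countableApprox
  -- S2: the joint limit factors through the conformal modulus
  obtain ⟨G, hG⟩ := h₂ u hu g hg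
  refine ⟨u, hu, ?_⟩
  intro R φ x hx
  -- S3: the factor is Cardy's function at every uniformizing datum
  have hR : g R = Literature.Probability.RandomPlanarGeometry.cardyFunction
      (Literature.Probability.RandomPlanarGeometry.crossRatio x) :=
    h₃ u hu g hg G hG R φ x hx
  rw [← hR]
  exact hg R

/-- **`SubseqCardy` from the two existing items by name** (landed as the registered sub-goal
`subseqCardy_of_items` of `Theorems/CardyAnchoredRigiditySubseqCardyReduction.lean`): X_M (stmt-8266)
along `1/(n+1)` and sequential rigidity (stmt-8271). -/
theorem SubseqCardy_of_items (hXM : CardyMirrorMonotone.SubseqConformalInvariance)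
    (hRig : CardyMirrorMonotone.SubseqRigidity) :
    Summit.CriticalPhenomena.CardyFormulaZ2.Theses.CardyAnchoredRigidity.SubseqCardy :=
  subseqCardy_of_items hXM hRig

/-- **The shared copy.** The crux decl is shared verbatim by route `CardyLocalRigidity`
(`CardyLocalRigidity.SubseqCardy`, same item stmt-CriticalPhenomena-5768); the two `def`s have the
same body, so the composition concludes that copy too (definitional unfolding, no `sorry`). -/
theorem SubseqCardy_proof (h₂ : Registered.stub_limitConformal)
    (h₃ : Registered.stub_conformalLimitIsCardy) :
    Summit.CriticalPhenomena.CardyFormulaZ2.Theses.CardyLocalRigidity.SubseqCardy :=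
  SubseqCardy_of h₂ h₃

/-- The shared copy from the two existing items by name (8266, 8271). -/
theorem SubseqCardy_proof_of_items (hXM : CardyMirrorMonotone.SubseqConformalInvariance)
    (hRig : CardyMirrorMonotone.SubseqRigidity) :
    Summit.CriticalPhenomena.CardyFormulaZ2.Theses.CardyLocalRigidity.SubseqCardy :=
  subseqCardy_of_items hXM hRig

/-- **`SubseqCardy` from X_M (stmt-8266) and the SEQUENTIAL CROSSING-MARTINGALE input** (cycle c5,
kernel facts part 4; landed as `subseqCardy_of_subseqConformalInvariance_of_seqCrossingMartingale`):
the martingale route to S3 / 8271 with all its analysis done — the second hypothesis is the sequential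
twin of STUB A of line `crossing_martingale` of crux `CardyRigidity` (stmt-0746). -/
theorem SubseqCardy_of_XM_of_seqCM (hXM : CardyMirrorMonotone.SubseqConformalInvariance)
    (hA : ∀ u : ℕ → ℝ, Filter.Tendsto u Filter.atTop (nhdsWithin (0 : ℝ) (Set.Ioi 0)) → ∀ f : ℝ → ℝ,
      (∀ (R : Literature.Probability.RandomPlanarGeometry.ConformalRectangle)
        (φ : Literature.Probability.RandomPlanarGeometry.ConformalEquiv UpperHalfPlane.upperHalfPlaneSet R.carrier)
        (x : Fin 4 → ℝ), R.IsUniformizing φ x →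
        Filter.Tendsto (fun n => Literature.Probability.Percolation.bondDomainCrossingProb R (u n)) Filter.atTop
          (nhds (f (Literature.Probability.RandomPlanarGeometry.crossRatio x)))) →
      ∃ (Ω : Type) (_ : MeasurableSpace Ω) (μ : MeasureTheory.Measure Ω) (_ : MeasureTheory.IsProbabilityMeasure μ)
        (W : Ω → NNReal → ℝ) (𝓕 : MeasureTheory.Filtration NNReal ‹MeasurableSpace Ω›),
        Summit.CriticalPhenomena.CardyFormulaZ2.Cruxes.CardyRigidity.CrossingMartingale.IsRegularDriver μ W 𝓕 ∧
        Summit.CriticalPhenomena.CardyFormulaZ2.Cruxes.CardyRigidity.CrossingMartingale.IsCrossingMartingaleFamily f μ W 𝓕) :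
    Summit.CriticalPhenomena.CardyFormulaZ2.Theses.CardyAnchoredRigidity.SubseqCardy :=
  subseqCardy_of_subseqConformalInvariance_of_seqCrossingMartingale hXM hA

/-- Wiring check: the registered (sorried) stubs feed `SubseqCardy_of` / `SubseqCardy_proof` exactly
as stated (so the `Registered` aliases agree with the stub signatures). `example`s, so that the four
theorems above stay the only named theorems of this file concluding the crux. -/
example : Summit.CriticalPhenomena.CardyFormulaZ2.Theses.CardyAnchoredRigidity.SubseqCardy :=
  SubseqCardy_of stub_limitConformal stub_conformalLimitIsCardy

example : Summit.CriticalPhenomena.CardyFormulaZ2.Theses.CardyLocalRigidity.SubseqCardy :=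
  SubseqCardy_proof stub_limitConformal stub_conformalLimitIsCardy

end Summit.CriticalPhenomena.CardyFormulaZ2.Cruxes.SubseqCardy.Birth
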